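import Literature.AlgebraicTopology.KTheory.BottIndex1
import HarnessLib

/-!
# The index map of Bott periodicity, II: `[Lᵈ(p)₊]` under padding and shifting; the invariant `J`

Husemöller, *Fibre Bundles*, Ch. 11 Prop. 4.8 (for the trivial bundle), via the block homotopies
of `BottIndexAlg.lean` realised as invertible linear clutching matrices over `X × [0,1]`:

* `plusClass_snocZero : [Lᵈ⁺¹(p)₊] = [Lᵈ(p)₊]` (padding the degree, Prop. 3.3 homotopy);
* `plusClass_consZero : [Lᵈ⁺¹(zp)₊] = [Lᵈ(p)₊] + N` (shifting, Prop. 3.4 homotopy and a row swap);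
* the polynomial coefficients `lcoeff A e s d` of `zˢ · ∑ z^{eᵢ} Aᵢ` for admissible `(s, d)`
  (`Adm`, `zA_pow_smul_laurentMatrix'`), and the invariant
  **`Jval A e s d = [Lᵈ(zˢ L)₊] - s·n ∈ K⁰(X)`** with `Jval_indep`: independence of the
  admissible `(s, d)` (Husemöller 11 Prop. 5.2).

Everything is proved; no named facts.

## References

* D. Husemöller, *Fibre Bundles*, 3rd ed. (1994) [HusemollerFibreBundles1994]: Ch. 11 Props.
  3.3, 3.4, 4.8, Notation 5.1, Prop. 5.2.
-/

noncomputable section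

open Set Metric unitInterval Complex

namespace Literature.AlgebraicTopology.KTheory

open Literature.RingTheory.KTheory Matrix Pencil Linearization

universe u

variable {X : Type u} [TopologicalSpace X]
variable {κ : Type} [Fintype κ] [DecidableEq κ] {d N : ℕ}

/-! ### Families over `X × [0,1]`: the coordinate `t` and lifts from `X` -/

variable (X) in
/-- The coordinate `t` as a scalar function on `X × [0,1]`. [folklore] -/
def tY : C(X × I, ℂ) := ⟨fun p ↦ ((p.2 : ℝ) : ℂ), by fun_prop⟩

/-- Auxiliary statement for the index map of Bott periodicity. [folklore] -/
theorem comapRingHom_πA_tY : comapRingHom (πA (X := X × I)) (tY X) = sCoord := by ext z; rfl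

/-- Auxiliary statement for the index map of Bott periodicity. [folklore] -/
theorem comapRingHom_sliceIncl_tY (t : I) : comapRingHom (sliceIncl (X := X) t) (tY X) = algebraMap ℂ _ ((t : ℝ) : ℂ) := by ext x; rfl

/-- Lift of a matrix over `X` to `X × [0,1]`. [folklore] -/
def liftY (M : Matrix κ κ C(X, ℂ)) : Matrix κ κ C(X × I, ℂ) := M.map (comapRingHom ContinuousMap.fst)

omit [Fintype κ] [DecidableEq κ] in
/-- Auxiliary statement for the index map of Bott periodicity. [folklore] -/
@[simp] theorem liftY_slice (M : Matrix κ κ C(X, ℂ)) (t : I) : (liftY M).map (comapRingHom (sliceIncl t)) = M := by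
  ext i j x; rfl

omit [Fintype κ] [DecidableEq κ] in
/-- Auxiliary statement for the index map of Bott periodicity. [folklore] -/
theorem liftY_liftA (M : Matrix κ κ C(X, ℂ)) :
    (liftY M).map (comapRingHom (πA (X := X × I))) = ((M.map (comapRingHom πA)).map (comapRingHom fstOverlap)) := by
  ext i j z; rfl

/-- The coefficients lifted to the overlap over `X × [0,1]`. [folklore] -/
abbrev coeffAY (a : Fin (d + 1) → Matrix (Fin N) (Fin N) C(X, ℂ)) :
    Fin (d + 1) → Matrix (Fin N) (Fin N) C(↥(pieceUp (X × I) ∩ pieceDn (X × I)), ℂ) :=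
  fun k ↦ (coeffA a k).map (comapRingHom fstOverlap)

/-- An inverse of `Lᵈ(p)` over the overlap of `X × [0,1]` from an inverse of `p`. [folklore] -/
theorem exists_LInv_Y (a : Fin (d + 1) → Matrix (Fin N) (Fin N) C(X, ℂ)) (hp : IsUnit (polyClutch a)) :
    ∃ LInv : Blk d (Fin N) C(↥(pieceUp (X × I) ∩ pieceDn (X × I)), ℂ),
      Lmat (coeffAY a) zA * LInv = 1 ∧ LInv * Lmat (coeffAY a) zA = 1 := by
  obtain ⟨pu, hpu⟩ := hp
  have hp' : polyEval (coeffAY a) zA = (polyClutch a).map (comapRingHom fstOverlap) := by rw [polyEval_map]; rfl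
  set pinv := (↑pu⁻¹ : Matrix (Fin N) (Fin N) _).map (comapRingHom (fstOverlap (X := X)))
  have h1 : polyEval (coeffAY a) zA * pinv = 1 := by
    rw [hp', ← Matrix.map_mul, ← hpu, pu.mul_inv, Matrix.map_one _ (map_zero _) (map_one _)]
  have h2 : pinv * polyEval (coeffAY a) zA = 1 := by
    rw [hp', ← Matrix.map_mul, ← hpu, pu.inv_mul, Matrix.map_one _ (map_zero _) (map_one _)]
  exact ⟨LtInv (coeffAY a) zA 1 pinv, Lmat_mul_LtInv _ _ h1, LtInv_mul_Lmat _ _ h2⟩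

/-- An inverse of `Lᵈ(p)` over the overlap of `X`. [folklore] -/
theorem exists_LInv (a : Fin (d + 1) → Matrix (Fin N) (Fin N) C(X, ℂ)) (hp : IsUnit (polyClutch a)) :
    ∃ LInv : Blk d (Fin N) C(↥(pieceUp X ∩ pieceDn X), ℂ), Lmat (coeffA a) zA * LInv = 1 ∧ LInv * Lmat (coeffA a) zA = 1 := by
  obtain ⟨pu, hpu⟩ := hp
  have h1 := pu.mul_inv; have h2 := pu.inv_mul
  rw [hpu] at h1 h2
  exact ⟨LtInv (coeffA a) zA 1 ↑pu⁻¹, Lmat_mul_LtInv _ _ h1, LtInv_mul_Lmat _ _ h2⟩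

/-! ### `Matrix.comp` bookkeeping -/

/-- `liftA ∘ comp = comp ∘ (blockwise liftA)`. [folklore] -/
theorem liftA_comp {α : Type} {Y : Type*} [TopologicalSpace Y] (M : Matrix α α (Matrix κ κ C(Y, ℂ))) :
    liftA (Matrix.comp _ _ _ _ _ M) = Matrix.comp _ _ _ _ _ (M.map (comapRingHom (πA (X := Y))).mapMatrix) := by
  rw [liftA, ← Matrix.comp_map_map]; rfl

/-- Auxiliary statement for the index map of Bott periodicity. [folklore] -/
theorem comp_map_slice {α : Type} (M : Matrix α α (Matrix κ κ C(X × I, ℂ))) (t : I) :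
    (Matrix.comp _ _ _ _ _ M).map (comapRingHom (sliceIncl t)) = Matrix.comp _ _ _ _ _ (M.map (comapRingHom (sliceIncl (X := X) t)).mapMatrix) := by
  rw [← Matrix.comp_map_map]; rfl

omit [Fintype κ] [DecidableEq κ] in
/-- `comp` commutes with re-indexing of the block structure. [folklore] -/
theorem comp_reindex {α β : Type} {R : Type*} (e : α ≃ β) (M : Matrix α α (Matrix κ κ R)) :
    Matrix.comp _ _ _ _ _ (Matrix.reindex e e M) = Matrix.reindex (e.prodCongr (Equiv.refl κ)) (e.prodCongr (Equiv.refl κ)) (Matrix.comp _ _ _ _ _ M) := by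
  ext ⟨i, k⟩ ⟨j, l⟩; rfl

omit [Fintype κ] [DecidableEq κ] in
/-- `comp` is additive and `C`-linear (definitionally). [folklore] -/
theorem comp_add_smul {α : Type} {R : Type*} [CommRing R] (A B : Matrix α α (Matrix κ κ R)) (z : R) :
    Matrix.comp _ _ _ _ _ (A + z • B) = Matrix.comp _ _ _ _ _ A + z • Matrix.comp _ _ _ _ _ B := rfl

omit [Fintype κ] [DecidableEq κ] in
/-- Auxiliary statement for the index map of Bott periodicity. [folklore] -/
theorem comp_zero' {α β : Type} {R : Type*} [CommRing R] : Matrix.comp α β κ κ R 0 = 0 := rfl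

/-! ### (3.3) at the level of `+`-classes: padding the degree -/

section J33

variable [CompactSpace X] [T2Space X]

/-- The `z`-part of the (3.3) family over `X × [0,1]`. [cite: HusemollerFibreBundles1994, Ch. 11 Prop. 3.3] -/
def aY33 (d N : ℕ) : Matrix ((Fin (d + 1) ⊕ Fin 1) × Fin N) ((Fin (d + 1) ⊕ Fin 1) × Fin N) C(X × I, ℂ) :=
  Matrix.comp _ _ _ _ _ (H33B d (tY X))

/-- The constant part of the (3.3) family over `X × [0,1]`. [cite: HusemollerFibreBundles1994, Ch. 11 Prop. 3.3] -/
def bY33 (a : Fin (d + 1) → Matrix (Fin N) (Fin N) C(X, ℂ)) : Matrix ((Fin (d + 1) ⊕ Fin 1) × Fin N) ((Fin (d + 1) ⊕ Fin 1) × Fin N) C(X × I, ℂ) :=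
  Matrix.comp _ _ _ _ _ (H33A fun k ↦ liftY (a k))

omit [CompactSpace X] [T2Space X] in
/-- Auxiliary statement for the index map of Bott periodicity. [folklore] -/
theorem linClutch_aY33_bY33 (a : Fin (d + 1) → Matrix (Fin N) (Fin N) C(X, ℂ)) :
    linClutch (aY33 d N) (bY33 a) = Matrix.comp _ _ _ _ _ (H33 (coeffAY a) zA sCoord) := by
  rw [H33_eq, comp_add_smul, linClutch, aY33, bY33, liftA_comp, liftA_comp, H33B_map, H33A_map, comapRingHom_πA_tY]
  exact add_comm _ _

omit [CompactSpace X] [T2Space X] in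
/-- Auxiliary statement for the index map of Bott periodicity. [folklore] -/
theorem isUnit_linClutch_aY33 (a : Fin (d + 1) → Matrix (Fin N) (Fin N) C(X, ℂ)) (hp : IsUnit (polyClutch a)) :
    IsUnit (linClutch (aY33 d N) (bY33 a)) := by
  rw [linClutch_aY33_bY33]
  obtain ⟨LInv, h1, h2⟩ := exists_LInv_Y a hp
  have hH : IsUnit (H33 (coeffAY a) zA sCoord) := ⟨⟨_, _, H33_mul_H33Inv _ _ _ h1, H33Inv_mul_H33 _ _ _ h2⟩, rfl⟩
  exact hH.map (Matrix.compRingEquiv _ _ _)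

omit [CompactSpace X] [T2Space X] in
/-- Auxiliary statement for the index map of Bott periodicity. [folklore] -/
theorem aY33_slice (t : I) : (aY33 (X := X) d N).map (comapRingHom (sliceIncl t)) = Matrix.comp _ _ _ _ _ (H33B d (algebraMap ℂ C(X, ℂ) ((t : ℝ) : ℂ))) := by
  rw [aY33, comp_map_slice, H33B_map, comapRingHom_sliceIncl_tY]

omit [CompactSpace X] [T2Space X] in
/-- Auxiliary statement for the index map of Bott periodicity. [folklore] -/
theorem bY33_slice (a : Fin (d + 1) → Matrix (Fin N) (Fin N) C(X, ℂ)) (t : I) :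
    (bY33 a).map (comapRingHom (sliceIncl t)) = Matrix.comp _ _ _ _ _ (H33A a) := by
  rw [bY33, comp_map_slice, H33A_map]
  simp only [liftY_slice]

omit [T2Space X] in
/-- The `z`-free parts of `Lᵈ⁺¹(snocZero a)` are the re-indexed `z`-free parts of `H₃₃(0)`. [cite: HusemollerFibreBundles1994, Ch. 11 Prop. 3.3] -/
theorem reindex_H33A (a : Fin (d + 1) → Matrix (Fin N) (Fin N) C(X, ℂ)) :
    Matrix.reindex finSumFinEquiv finSumFinEquiv (H33A a) = LmatA (snocZero a) := by
  have h := reindex_H33_zero a (0 : C(X, ℂ))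
  rwa [H33_eq, Lmat_eq, zero_smul, zero_smul, add_zero, add_zero] at h

omit [T2Space X] in
/-- Auxiliary statement for the index map of Bott periodicity. [folklore] -/
theorem reindex_H33B_zero :
    Matrix.reindex finSumFinEquiv finSumFinEquiv (H33B d 0 : Matrix _ _ (Matrix (Fin N) (Fin N) C(X, ℂ))) = LmatB (d + 1) (Fin N) C(X, ℂ) := by
  have h := reindex_H33_zero (fun _ : Fin (d + 1) ↦ (0 : Matrix (Fin N) (Fin N) C(X, ℂ))) (1 : C(X, ℂ))
  simp only [H33_eq, Lmat_eq, one_smul, Matrix.reindex_apply, Matrix.submatrix_add, Pi.add_apply] at h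
  have hA := reindex_H33A (fun _ : Fin (d + 1) ↦ (0 : Matrix (Fin N) (Fin N) C(X, ℂ)))
  rw [Matrix.reindex_apply] at hA ⊢
  rw [hA] at h
  exact add_left_cancel h

/-- **Padding the degree does not change `[L(p)₊]`** (Husemöller 11 Prop. 4.8, first formula, for
the trivial bundle): `[Lᵈ⁺¹(p)₊] = [Lᵈ(p)₊]`. [cite: HusemollerFibreBundles1994, Ch. 11 Prop. 4.8] -/
theorem plusClass_snocZero (a : Fin (d + 1) → Matrix (Fin N) (Fin N) C(X, ℂ)) (hp : IsUnit (polyClutch a))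
    (h₁ : IsUnit (linClutch (linA X d N) (linB a))) (h₂ : IsUnit (linClutch (linA X (d + 1) N) (linB (snocZero a)))) :
    plusClass (linA X (d + 1) N) (linB (snocZero a)) h₂ = plusClass (linA X d N) (linB a) h₁ := by
  have hY := isUnit_linClutch_aY33 a hp
  have hs := fun t ↦ isUnit_linClutch_map hY (sliceIncl t)
  -- slice 0 ↔ the padded linearisation
  have e0a : linA X (d + 1) N = Matrix.reindex ((finSumFinEquiv (m := d + 1) (n := 1)).prodCongr (Equiv.refl (Fin N)))
      (finSumFinEquiv.prodCongr (Equiv.refl (Fin N))) ((aY33 (X := X) d N).map (comapRingHom (sliceIncl 0))) := by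
    rw [aY33_slice, ← comp_reindex]
    change Matrix.comp _ _ _ _ _ (LmatB (d + 1) (Fin N) C(X, ℂ)) = _
    rw [← reindex_H33B_zero]
    have : (algebraMap ℂ C(X, ℂ)) (((0 : I) : ℝ) : ℂ) = 0 := by simp
    rw [this]
  have e0b : linB (snocZero a) = Matrix.reindex ((finSumFinEquiv (m := d + 1) (n := 1)).prodCongr (Equiv.refl (Fin N)))
      (finSumFinEquiv.prodCongr (Equiv.refl (Fin N))) ((bY33 a).map (comapRingHom (sliceIncl 0))) := by
    rw [bY33_slice, ← comp_reindex, reindex_H33A]; rfl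
  rw [plusClass_congr h₂ (by rw [← e0a, ← e0b]; exact h₂) e0a e0b, plusClass_reindex _ _ _ (hs 0), plusClass_slice_eq _ _ hY 0 1 (hs 0) (hs 1)]
  -- slice 1 is block diagonal
  have e1a : (aY33 (X := X) d N).map (comapRingHom (sliceIncl 1)) =
      Matrix.reindex (Equiv.sumProdDistrib _ _ _).symm (Equiv.sumProdDistrib _ _ _).symm (Matrix.fromBlocks (linA X d N) 0 0 (0 : Matrix (Fin 1 × Fin N) (Fin 1 × Fin N) C(X, ℂ))) := by
    rw [aY33_slice]
    have : (algebraMap ℂ C(X, ℂ)) (((1 : I) : ℝ) : ℂ) = 1 := by simp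
    rw [this, H33B_one, comp_fromBlocks]; rfl
  have e1b : (bY33 a).map (comapRingHom (sliceIncl 1)) =
      Matrix.reindex (Equiv.sumProdDistrib _ _ _).symm (Equiv.sumProdDistrib _ _ _).symm (Matrix.fromBlocks (linB a) 0 0 (1 : Matrix (Fin 1 × Fin N) (Fin 1 × Fin N) C(X, ℂ))) := by
    rw [bY33_slice, H33A, comp_fromBlocks, Matrix.comp_one]; rfl
  have h01 : IsUnit (linClutch (0 : Matrix (Fin 1 × Fin N) (Fin 1 × Fin N) C(X, ℂ)) 1) := by
    rw [linClutch, liftA, liftA, Matrix.map_zero _ (map_zero _), smul_zero, zero_add, Matrix.map_one _ (map_zero _) (map_one _)]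
    exact isUnit_one
  have hblk := isUnit_linClutch_fromBlocks h₁ h01
  rw [plusClass_congr (hs 1) (by rw [← e1a, ← e1b]; exact hs 1) e1a e1b, plusClass_reindex _ _ _ hblk, plusClass_fromBlocks _ _ _ _ h₁ h01,
    plusClass_zero_left, add_zero]

end J33

/-! ### (3.4) at the level of `+`-classes: shifting by `z` -/

section J34

variable [CompactSpace X] [T2Space X]

/-- The `z`-part of the (3.4) family over `X × [0,1]` (constant in `t`). [cite: HusemollerFibreBundles1994, Ch. 11 Prop. 3.4] -/
def aY34 (d N : ℕ) : Matrix ((Fin 1 ⊕ Fin (d + 1)) × Fin N) ((Fin 1 ⊕ Fin (d + 1)) × Fin N) C(X × I, ℂ) :=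
  Matrix.comp _ _ _ _ _ (H34B d)

/-- The constant part of the (3.4) family over `X × [0,1]`. [cite: HusemollerFibreBundles1994, Ch. 11 Prop. 3.4] -/
def bY34 (a : Fin (d + 1) → Matrix (Fin N) (Fin N) C(X, ℂ)) : Matrix ((Fin 1 ⊕ Fin (d + 1)) × Fin N) ((Fin 1 ⊕ Fin (d + 1)) × Fin N) C(X × I, ℂ) :=
  Matrix.comp _ _ _ _ _ (H34A (fun k ↦ liftY (a k)) (tY X))

omit [CompactSpace X] [T2Space X] in
/-- Auxiliary statement for the index map of Bott periodicity. [folklore] -/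
theorem linClutch_aY34_bY34 (a : Fin (d + 1) → Matrix (Fin N) (Fin N) C(X, ℂ)) :
    linClutch (aY34 d N) (bY34 a) = Matrix.comp _ _ _ _ _ (H34 (coeffAY a) zA sCoord) := by
  rw [H34_eq, comp_add_smul, linClutch, aY34, bY34, liftA_comp, liftA_comp, H34B_map, H34A_map, comapRingHom_πA_tY]
  exact add_comm _ _

omit [CompactSpace X] [T2Space X] in
/-- Auxiliary statement for the index map of Bott periodicity. [folklore] -/
theorem isUnit_linClutch_aY34 (a : Fin (d + 1) → Matrix (Fin N) (Fin N) C(X, ℂ)) (hp : IsUnit (polyClutch a)) :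
    IsUnit (linClutch (aY34 d N) (bY34 a)) := by
  rw [linClutch_aY34_bY34]
  obtain ⟨LInv, h1, h2⟩ := exists_LInv_Y a hp
  have hH : IsUnit (H34 (coeffAY a) zA sCoord) :=
    ⟨⟨_, _, H34_mul_H34Inv _ zA_mul_zAbar h1, H34Inv_mul_H34 _ zAbar_mul_zA h2⟩, rfl⟩
  exact hH.map (Matrix.compRingEquiv _ _ _)

omit [CompactSpace X] [T2Space X] in
/-- Auxiliary statement for the index map of Bott periodicity. [folklore] -/
theorem aY34_slice (t : I) : (aY34 (X := X) d N).map (comapRingHom (sliceIncl t)) = Matrix.comp _ _ _ _ _ (H34B d) := by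
  rw [aY34, comp_map_slice, H34B_map]

omit [CompactSpace X] [T2Space X] in
/-- Auxiliary statement for the index map of Bott periodicity. [folklore] -/
theorem bY34_slice (a : Fin (d + 1) → Matrix (Fin N) (Fin N) C(X, ℂ)) (t : I) :
    (bY34 a).map (comapRingHom (sliceIncl t)) = Matrix.comp _ _ _ _ _ (H34A a (algebraMap ℂ C(X, ℂ) ((t : ℝ) : ℂ))) := by
  rw [bY34, comp_map_slice, H34A_map, comapRingHom_sliceIncl_tY]
  simp only [liftY_slice]

omit [T2Space X] in
/-- Auxiliary statement for the index map of Bott periodicity. [folklore] -/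
theorem reindex_H34A_zero (a : Fin (d + 1) → Matrix (Fin N) (Fin N) C(X, ℂ)) :
    Matrix.reindex (e34 d) (e34 d) (H34A a 0) = (LmatA (consZero a)).submatrix (Equiv.swap 0 1) id := by
  have h := reindex_H34_zero a (0 : C(X, ℂ))
  rwa [H34_eq, Lmat_eq, zero_smul, zero_smul, add_zero, add_zero] at h

omit [T2Space X] in
/-- Auxiliary statement for the index map of Bott periodicity. [folklore] -/
theorem reindex_H34B :
    Matrix.reindex (e34 d) (e34 d) (H34B d : Matrix _ _ (Matrix (Fin N) (Fin N) C(X, ℂ))) = (LmatB (d + 1) (Fin N) C(X, ℂ)).submatrix (Equiv.swap 0 1) id := by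
  have h := reindex_H34_zero (fun _ : Fin (d + 1) ↦ (0 : Matrix (Fin N) (Fin N) C(X, ℂ))) (1 : C(X, ℂ))
  simp only [H34_eq, Lmat_eq, one_smul, Matrix.reindex_apply, Matrix.submatrix_add, Pi.add_apply] at h
  have hA := reindex_H34A_zero (fun _ : Fin (d + 1) ↦ (0 : Matrix (Fin N) (Fin N) C(X, ℂ)))
  rw [Matrix.reindex_apply] at hA ⊢
  rw [hA] at h
  exact add_left_cancel h

/-- The block-row swap as a permutation matrix over `X`. [folklore] -/
def Pswap (d N : ℕ) : Matrix (Fin (d + 2) × Fin N) (Fin (d + 2) × Fin N) C(X, ℂ) :=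
  (1 : Matrix (Fin (d + 2) × Fin N) (Fin (d + 2) × Fin N) C(X, ℂ)).submatrix (Prod.map (Equiv.swap 0 1) id) (Equiv.refl _)

omit [CompactSpace X] [T2Space X] in
/-- Auxiliary statement for the index map of Bott periodicity. [folklore] -/
theorem Pswap_mul (M : Matrix (Fin (d + 2) × Fin N) (Fin (d + 2) × Fin N) C(X, ℂ)) :
    Pswap d N * M = M.submatrix (Prod.map (Equiv.swap 0 1) id) id := by
  rw [Pswap, Matrix.one_submatrix_mul]; rfl

omit [CompactSpace X] [T2Space X] in
/-- Auxiliary statement for the index map of Bott periodicity. [folklore] -/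
theorem Pswap_mul_Pswap : Pswap (X := X) d N * Pswap d N = 1 := by
  rw [Pswap_mul, Pswap, Matrix.submatrix_submatrix]
  have : (Prod.map (Equiv.swap (0 : Fin (d + 2)) 1) (id : Fin N → Fin N)) ∘ (Prod.map (Equiv.swap (0 : Fin (d + 2)) 1) id) = id := by
    funext ⟨i, k⟩
    simp [Prod.map, Equiv.swap_apply_self]
  rw [this]; rfl

omit [CompactSpace X] [T2Space X] in
/-- Auxiliary statement for the index map of Bott periodicity. [folklore] -/
theorem isUnit_Pswap : IsUnit (Pswap (X := X) d N) := ⟨⟨_, _, Pswap_mul_Pswap, Pswap_mul_Pswap⟩, rfl⟩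

omit [CompactSpace X] [T2Space X] in
/-- `Pσ · comp M = comp` of the row-swapped block matrix, re-indexed. [folklore] -/
theorem Pswap_mul_comp (M : Blk (d + 1) (Fin N) C(X, ℂ)) :
    Pswap d N * Matrix.comp _ _ _ _ _ M = Matrix.comp _ _ _ _ _ (M.submatrix (Equiv.swap 0 1) id) := by
  rw [Pswap_mul, comp_submatrix]; rfl

/-- **Multiplying by `z` adds `N` to `[L(p)₊]`** (Husemöller 11 Prop. 4.8, second formula, for the
trivial bundle): `[Lᵈ⁺¹(zp)₊] = [Lᵈ(p)₊] + N`. [cite: HusemollerFibreBundles1994, Ch. 11 Prop. 4.8] -/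
theorem plusClass_consZero (a : Fin (d + 1) → Matrix (Fin N) (Fin N) C(X, ℂ)) (hp : IsUnit (polyClutch a))
    (h₁ : IsUnit (linClutch (linA X d N) (linB a))) (h₂ : IsUnit (linClutch (linA X (d + 1) N) (linB (consZero a)))) :
    plusClass (linA X (d + 1) N) (linB (consZero a)) h₂ = plusClass (linA X d N) (linB a) h₁ + N := by
  have hY := isUnit_linClutch_aY34 a hp
  have hs := fun t ↦ isUnit_linClutch_map hY (sliceIncl t)
  -- slice 0 ↔ the shifted linearisation with block rows 0, 1 swapped
  have e0a : Pswap d N * linA X (d + 1) N = Matrix.reindex ((e34 d).prodCongr (Equiv.refl (Fin N))) ((e34 d).prodCongr (Equiv.refl (Fin N)))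
      ((aY34 (X := X) d N).map (comapRingHom (sliceIncl 0))) := by
    rw [aY34_slice, ← comp_reindex, reindex_H34B]
    exact Pswap_mul_comp _
  have e0b : Pswap d N * linB (consZero a) = Matrix.reindex ((e34 d).prodCongr (Equiv.refl (Fin N))) ((e34 d).prodCongr (Equiv.refl (Fin N)))
      ((bY34 a).map (comapRingHom (sliceIncl 0))) := by
    rw [bY34_slice, ← comp_reindex]
    have : (algebraMap ℂ C(X, ℂ)) (((0 : I) : ℝ) : ℂ) = 0 := by simp
    rw [this, reindex_H34A_zero]
    exact Pswap_mul_comp _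
  have hP := isUnit_linClutch_unit_mul isUnit_Pswap h₂
  rw [← plusClass_unit_mul isUnit_Pswap h₂ hP, plusClass_congr hP (by rw [← e0a, ← e0b]; exact hP) e0a e0b,
    plusClass_reindex _ _ _ (hs 0), plusClass_slice_eq _ _ hY 0 1 (hs 0) (hs 1)]
  -- slice 1 is block diagonal `(-1, 0) ⊕ (linA, linB a)`
  have e1a : (aY34 (X := X) d N).map (comapRingHom (sliceIncl 1)) =
      Matrix.reindex (Equiv.sumProdDistrib _ _ _).symm (Equiv.sumProdDistrib _ _ _).symm
        (Matrix.fromBlocks (-1 : Matrix (Fin 1 × Fin N) (Fin 1 × Fin N) C(X, ℂ)) 0 0 (linA X d N)) := by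
    rw [aY34_slice, H34B, comp_fromBlocks]
    have : Matrix.comp (Fin 1) (Fin 1) (Fin N) (Fin N) C(X, ℂ) (-1) = -1 := by
      rw [← Matrix.compRingEquiv_apply, map_neg, map_one]
    rw [this]; rfl
  have e1b : (bY34 a).map (comapRingHom (sliceIncl 1)) =
      Matrix.reindex (Equiv.sumProdDistrib _ _ _).symm (Equiv.sumProdDistrib _ _ _).symm
        (Matrix.fromBlocks (0 : Matrix (Fin 1 × Fin N) (Fin 1 × Fin N) C(X, ℂ)) 0 0 (linB a)) := by
    rw [bY34_slice]
    have : (algebraMap ℂ C(X, ℂ)) (((1 : I) : ℝ) : ℂ) = 1 := by simp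
    rw [this, H34A_one, comp_fromBlocks]; rfl
  have h10 : IsUnit (linClutch (-1 : Matrix (Fin 1 × Fin N) (Fin 1 × Fin N) C(X, ℂ)) 0) := by
    rw [linClutch, liftA, liftA, Matrix.map_zero _ (map_zero _), add_zero, Matrix.map_neg _ (map_neg _), Matrix.map_one _ (map_zero _) (map_one _),
      smul_neg, ← Algebra.algebraMap_eq_smul_one]
    have hz : IsUnit (zA : C(↥(pieceUp X ∩ pieceDn X), ℂ)) := ⟨⟨zA, zAbar, zA_mul_zAbar, zAbar_mul_zA⟩, rfl⟩
    exact (hz.map (algebraMap _ (Matrix (Fin 1 × Fin N) (Fin 1 × Fin N) C(↥(pieceUp X ∩ pieceDn X), ℂ)))).neg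
  have hneg : IsUnit (-1 : Matrix (Fin 1 × Fin N) (Fin 1 × Fin N) C(X, ℂ)) := isUnit_neg_one_matrix
  have hblk := isUnit_linClutch_fromBlocks h10 h₁
  rw [plusClass_congr (hs 1) (by rw [← e1a, ← e1b]; exact hs 1) e1a e1b, plusClass_reindex _ _ _ hblk, plusClass_fromBlocks _ _ _ _ h10 h₁,
    plusClass_of_b_zero hneg, add_comm]
  simp [Fintype.card_prod]

end J34

/-! ### Polynomial coefficients of `zˢ · (∑ᵢ z^{eᵢ} Aᵢ)` in degree `≤ d`, and the invariant `J` -/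

section Coeff

variable {n : ℕ} {ι' : Type} [Fintype ι']

/-- `(s, d)` is admissible for the exponents `e`: `0 ≤ eᵢ + s ≤ d`. [cite: HusemollerFibreBundles1994, Ch. 11 Notation 5.1] -/
def Adm (e : ι' → ℤ) (s d : ℕ) : Prop := ∀ i, 0 ≤ e i + s ∧ e i + s ≤ d

/-- The coefficients `a_k = ∑_{eᵢ + s = k} Aᵢ`, `k ≤ d`, of `zˢ · ∑ᵢ z^{eᵢ} Aᵢ`. [cite: HusemollerFibreBundles1994, Ch. 11 Notation 5.1] -/
def lcoeff (A : ι' → Matrix (Fin n) (Fin n) C(X, ℂ)) (e : ι' → ℤ) (s d : ℕ) : Fin (d + 1) → Matrix (Fin n) (Fin n) C(X, ℂ) :=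
  fun k ↦ ∑ i ∈ Finset.univ.filter (fun i ↦ e i + s = (k : ℕ)), A i

omit [Fintype κ] [DecidableEq κ] [Fintype ι'] in
/-- Auxiliary statement for the index map of Bott periodicity. [folklore] -/
theorem Adm.mono_d {e : ι' → ℤ} {s d : ℕ} (h : Adm e s d) (j : ℕ) : Adm e s (d + j) :=
  fun i ↦ ⟨(h i).1, (h i).2.trans (by exact_mod_cast Nat.le_add_right d j)⟩

omit [Fintype κ] [DecidableEq κ] [Fintype ι'] in
/-- Auxiliary statement for the index map of Bott periodicity. [folklore] -/
theorem Adm.succ {e : ι' → ℤ} {s d : ℕ} (h : Adm e s d) : Adm e (s + 1) (d + 1) :=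
  fun i ↦ ⟨by have := (h i).1; push_cast; omega, by have := (h i).2; push_cast; omega⟩

/-- Padding: in degree `≤ d + 1` the coefficients are `snocZero` of those in degree `≤ d`. [folklore] -/
theorem lcoeff_succ_d (A : ι' → Matrix (Fin n) (Fin n) C(X, ℂ)) {e : ι' → ℤ} {s d : ℕ} (h : Adm e s d) :
    lcoeff A e s (d + 1) = snocZero (lcoeff A e s d) := by
  funext k
  induction k using Fin.lastCases with
  | last =>
    rw [snocZero_last, lcoeff]
    refine Finset.sum_eq_zero fun i hi ↦ ?_
    exfalso
    have := (Finset.mem_filter.1 hi).2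
    have := (h i).2
    simp [Fin.val_last] at *
    omega
  | cast k =>
    rw [snocZero_castSucc, lcoeff, lcoeff]
    simp only [Fin.val_castSucc]

/-- Shifting: the coefficients of `z · p` are `consZero` of those of `p`. [folklore] -/
theorem lcoeff_succ_s (A : ι' → Matrix (Fin n) (Fin n) C(X, ℂ)) {e : ι' → ℤ} {s d : ℕ} (h : Adm e s d) :
    lcoeff A e (s + 1) (d + 1) = consZero (lcoeff A e s d) := by
  funext k
  induction k using Fin.cases with
  | zero =>
    rw [consZero_zero, lcoeff]
    refine Finset.sum_eq_zero fun i hi ↦ ?_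
    exfalso
    have := (Finset.mem_filter.1 hi).2
    have := (h i).1
    simp at *
    omega
  | succ k =>
    rw [consZero_succ, lcoeff, lcoeff]
    simp only [Fin.val_succ]
    congr 1
    ext i
    simp only [Finset.mem_filter, Finset.mem_univ, true_and]
    push_cast
    omega

/-- The degree index of the `i`-th shifted monomial. [folklore] -/
def lIdx {e : ι' → ℤ} {s d : ℕ} (h : Adm e s d) (i : ι') : Fin (d + 1) :=
  ⟨(e i + s).toNat, by have := (h i).2; have := (h i).1; omega⟩

omit [Fintype κ] [DecidableEq κ] [Fintype ι'] in
/-- Auxiliary statement for the index map of Bott periodicity. [folklore] -/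
theorem lIdx_val {e : ι' → ℤ} {s d : ℕ} (h : Adm e s d) (i : ι') : ((lIdx h i : Fin (d + 1)) : ℤ) = e i + s := by
  simp only [lIdx, Int.toNat_of_nonneg (h i).1]

omit [Fintype ι'] in
/-- `zˢ · z^{eᵢ} = z^{k}` with `k = eᵢ + s`. [folklore] -/
theorem zA_pow_mul_zU_zpow' {e : ι' → ℤ} {s d : ℕ} (h : Adm e s d) (i : ι') :
    (zA : C(↥(pieceUp X ∩ pieceDn X), ℂ)) ^ s * (((zU ^ (e i) : (C(↥(pieceUp X ∩ pieceDn X), ℂ))ˣ) : C(_, ℂ))) =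
      (zA : C(↥(pieceUp X ∩ pieceDn X), ℂ)) ^ ((lIdx h i : Fin _) : ℕ) := by
  have h1 : (zA : C(↥(pieceUp X ∩ pieceDn X), ℂ)) ^ s = ((zU ^ (s : ℤ) : (C(↥(pieceUp X ∩ pieceDn X), ℂ))ˣ) : C(↥(pieceUp X ∩ pieceDn X), ℂ)) := by
    rw [zpow_natCast, Units.val_pow_eq_pow_val]; rfl
  rw [h1, ← Units.val_mul, ← zpow_add]
  rw [show (s : ℤ) + e i = (((lIdx h i : Fin _) : ℕ) : ℤ) by rw [lIdx_val h i]; ring, zpow_natCast, Units.val_pow_eq_pow_val]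
  rfl

/-- **`zˢ · (∑ᵢ z^{eᵢ} Aᵢ) = ∑ₖ zᵏ aₖ`** for admissible `(s, d)`. [cite: HusemollerFibreBundles1994, Ch. 11 Notation 5.1] -/
theorem zA_pow_smul_laurentMatrix' (A : ι' → Matrix (Fin n) (Fin n) C(X, ℂ)) {e : ι' → ℤ} {s d : ℕ} (h : Adm e s d) :
    (zA : C(↥(pieceUp X ∩ pieceDn X), ℂ)) ^ s • laurentMatrix A e = polyClutch (lcoeff A e s d) := by
  ext p q : 1
  rw [Matrix.smul_apply, laurentMatrix_apply, smul_eq_mul, Finset.mul_sum, polyClutch, polyEval, Matrix.sum_apply]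
  simp only [Matrix.smul_apply, smul_eq_mul, coeffA, Matrix.map_apply, lcoeff, Matrix.sum_apply, map_sum, Finset.mul_sum]
  have hfib : ∀ k : Fin (d + 1), (Finset.univ.filter fun i ↦ e i + s = (k : ℕ)) = Finset.univ.filter fun i ↦ lIdx h i = k := by
    intro k; ext i
    simp only [Finset.mem_filter, Finset.mem_univ, true_and, Fin.ext_iff]
    constructor
    · intro hk; have := lIdx_val h i; zify; omega
    · intro hk; have := lIdx_val h i; zify at hk; omega
  simp only [hfib]
  rw [← Finset.sum_fiberwise (s := Finset.univ) (g := lIdx h)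
    (f := fun i ↦ (zA : C(↥(pieceUp X ∩ pieceDn X), ℂ)) ^ s *
      ((comapRingHom πA) (A i p q) * ((zU ^ e i : (C(↥(pieceUp X ∩ pieceDn X), ℂ))ˣ) : C(↥(pieceUp X ∩ pieceDn X), ℂ))))]
  refine Finset.sum_congr rfl fun k _ ↦ Finset.sum_congr rfl fun i hi ↦ ?_
  rw [← (Finset.mem_filter.1 hi).2, mul_left_comm, zA_pow_mul_zU_zpow' h, mul_comm]

/-- For admissible `(s,d)` and invertible `∑ z^{eᵢ} Aᵢ` the polynomial `zˢ L` is invertible. [folklore] -/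
theorem isUnit_polyClutch_lcoeff (A : ι' → Matrix (Fin n) (Fin n) C(X, ℂ)) {e : ι' → ℤ} {s d : ℕ} (h : Adm e s d) (hu : IsUnit (laurentMatrix A e)) :
    IsUnit (polyClutch (lcoeff A e s d)) := by
  rw [← zA_pow_smul_laurentMatrix' A h, Matrix.smul_eq_diagonal_mul]
  have hz : IsUnit (zA : C(↥(pieceUp X ∩ pieceDn X), ℂ)) := ⟨⟨zA, zAbar, zA_mul_zAbar, zAbar_mul_zA⟩, rfl⟩
  have h1 : IsUnit (Matrix.diagonal fun _ : Fin n ↦ (zA : C(↥(pieceUp X ∩ pieceDn X), ℂ)) ^ s) := by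
    have := (hz.pow s).map (Matrix.scalar (Fin n)); rwa [Matrix.scalar_apply] at this
  exact h1.mul hu

end Coeff

/-! ### The invariant `J(A, e; s, d) = [Lᵈ(zˢ L)₊] - s·n` and its independence of `(s, d)` -/

section Jval

variable [CompactSpace X] [T2Space X] {n : ℕ} {ι' : Type} [Fintype ι']

omit [Fintype κ] [DecidableEq κ] [CompactSpace X] [T2Space X] [Fintype ι'] in
/-- Auxiliary statement for the index map of Bott periodicity. [folklore] -/
theorem isUnit_linClutch_linA_linB {d : ℕ} (a : Fin (d + 1) → Matrix (Fin n) (Fin n) C(X, ℂ)) (hp : IsUnit (polyClutch a)) :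
    IsUnit (linClutch (linA X d n) (linB a)) := by
  rw [← comp_Lmat_eq_linClutch]; exact isUnit_comp_Lmat a hp

/-- **`J(A, e; s, d) = [Lᵈ(zˢ · ∑ z^{eᵢ} Aᵢ)₊] - s·n ∈ K⁰(X)`** (junk value `0` if the linearised
clutching matrix is not invertible). [cite: HusemollerFibreBundles1994, Ch. 11 Thm. 5.4] -/
def Jval (A : ι' → Matrix (Fin n) (Fin n) C(X, ℂ)) (e : ι' → ℤ) (s d : ℕ) : K0 X :=
  open scoped Classical in
  if h : IsUnit (linClutch (linA X d n) (linB (lcoeff A e s d))) then plusClass _ _ h - (s * n : ℕ) else 0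

omit [CompactSpace X] [T2Space X] in
/-- Auxiliary statement for the index map of Bott periodicity. [folklore] -/
theorem Jval_eq (A : ι' → Matrix (Fin n) (Fin n) C(X, ℂ)) {e : ι' → ℤ} {s d : ℕ} (h : IsUnit (linClutch (linA X d n) (linB (lcoeff A e s d)))) :
    Jval A e s d = plusClass _ _ h - (s * n : ℕ) := by
  rw [Jval, dif_pos h]

omit [CompactSpace X] [T2Space X] in
/-- Auxiliary statement for the index map of Bott periodicity. [folklore] -/
theorem isUnit_linClutch_lcoeff (A : ι' → Matrix (Fin n) (Fin n) C(X, ℂ)) {e : ι' → ℤ} {s d : ℕ} (h : Adm e s d) (hu : IsUnit (laurentMatrix A e)) :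
    IsUnit (linClutch (linA X d n) (linB (lcoeff A e s d))) :=
  isUnit_linClutch_linA_linB _ (isUnit_polyClutch_lcoeff A h hu)

/-- Padding invariance of `J`. [cite: HusemollerFibreBundles1994, Ch. 11 Prop. 5.2] -/
theorem Jval_succ_d (A : ι' → Matrix (Fin n) (Fin n) C(X, ℂ)) {e : ι' → ℤ} {s d : ℕ} (h : Adm e s d) (hu : IsUnit (laurentMatrix A e)) :
    Jval A e s (d + 1) = Jval A e s d := by
  have h1 := isUnit_linClutch_lcoeff A h hu
  have h2 := isUnit_linClutch_lcoeff A (h.mono_d 1) hu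
  rw [Jval_eq A h1, Jval_eq A h2]
  congr 1
  have e1 : linB (lcoeff A e s (d + 1)) = linB (snocZero (lcoeff A e s d)) := by rw [lcoeff_succ_d A h]
  have h3 : IsUnit (linClutch (linA X (d + 1) n) (linB (snocZero (lcoeff A e s d)))) := by rw [← e1]; exact h2
  rw [plusClass_congr h2 h3 rfl e1]
  exact plusClass_snocZero _ (isUnit_polyClutch_lcoeff A h hu) h1 h3

/-- Shift invariance of `J`. [cite: HusemollerFibreBundles1994, Ch. 11 Prop. 5.2] -/
theorem Jval_succ_s (A : ι' → Matrix (Fin n) (Fin n) C(X, ℂ)) {e : ι' → ℤ} {s d : ℕ} (h : Adm e s d) (hu : IsUnit (laurentMatrix A e)) :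
    Jval A e (s + 1) (d + 1) = Jval A e s d := by
  have h1 := isUnit_linClutch_lcoeff A h hu
  have h2 := isUnit_linClutch_lcoeff A h.succ hu
  rw [Jval_eq A h1, Jval_eq A h2]
  have e1 : linB (lcoeff A e (s + 1) (d + 1)) = linB (consZero (lcoeff A e s d)) := by rw [lcoeff_succ_s A h]
  have h3 : IsUnit (linClutch (linA X (d + 1) n) (linB (consZero (lcoeff A e s d)))) := by rw [← e1]; exact h2
  rw [plusClass_congr h2 h3 rfl e1, plusClass_consZero _ (isUnit_polyClutch_lcoeff A h hu) h1 h3]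
  push_cast
  ring

/-- Auxiliary statement for the index map of Bott periodicity. [folklore] -/
theorem Jval_add_d (A : ι' → Matrix (Fin n) (Fin n) C(X, ℂ)) {e : ι' → ℤ} {s d : ℕ} (h : Adm e s d) (hu : IsUnit (laurentMatrix A e)) (j : ℕ) :
    Jval A e s (d + j) = Jval A e s d := by
  induction j with
  | zero => rfl
  | succ j ih => rw [← add_assoc, Jval_succ_d A (h.mono_d j) hu, ih]

/-- Auxiliary statement for the index map of Bott periodicity. [folklore] -/
theorem Jval_add_s (A : ι' → Matrix (Fin n) (Fin n) C(X, ℂ)) {e : ι' → ℤ} {s d : ℕ} (h : Adm e s d) (hu : IsUnit (laurentMatrix A e)) (j : ℕ) :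
    Jval A e (s + j) (d + j) = Jval A e s d := by
  induction j with
  | zero => rfl
  | succ j ih =>
    have hj : Adm e (s + j) (d + j) := by
      clear ih
      induction j with
      | zero => exact h
      | succ j ih' => exact ih'.succ
    rw [← add_assoc, ← add_assoc, Jval_succ_s A hj hu, ih]

/-- **`J` does not depend on the admissible `(s, d)`.** [cite: HusemollerFibreBundles1994, Ch. 11 Prop. 5.2] -/
theorem Jval_indep (A : ι' → Matrix (Fin n) (Fin n) C(X, ℂ)) {e : ι' → ℤ} {s d s' d' : ℕ} (h : Adm e s d) (h' : Adm e s' d')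
    (hu : IsUnit (laurentMatrix A e)) : Jval A e s d = Jval A e s' d' := by
  wlog hle : s ≤ s' generalizing s d s' d'
  · exact (this h' h (le_of_not_ge hle)).symm
  obtain ⟨j, rfl⟩ := Nat.exists_eq_add_of_le hle
  have hj : Adm e (s + j) (d + j) := by
    clear hle h'
    induction j with
    | zero => exact h
    | succ j ih' => exact ih'.succ
  rw [← Jval_add_s A h hu j, ← Jval_add_d A hj hu d', ← Jval_add_d A h' hu (d + j), Nat.add_comm d' (d + j)]

end Jval

end Literature.AlgebraicTopology.KTheory

end
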